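import Literature.AnabelianGeometry.EtaleTheta.Discharge.Sec2DiscreteNormalizersInputs
import Literature.IUT.HodgeTheaters.ProfiniteCompletionNormalizers

/-!
# [EtTh] Lemma 2.17 (i): discharging the printed input (c) (centralizers of free generators)

Mochizuki, *The Étale Theta Function and its Frobenioid-theoretic Manifestations* [EtTh],
Publ. RIMS 45 (2009), §2, Lemma 2.17 (i), PRIMS text pp.58–59 (printed pp.284–285; bib key
`MochizukiEtTh2009`).  The proof of Lemma 2.17 (i) uses (p.59 = PRIMS p.285): "the centralizer of
`x_{i_j}` in the profinite completion `Ĵ` of `J` is topologically generated by `x_{i_j}` [cf., e.g.,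
[Mzk15], Proposition 1.2, (ii)]".  That input is now a THEOREM of the tree
(`Literature.IUT.HodgeTheaters.ProfiniteCompletion.centralizer_eta_basis_le_closure_zpowers`,
abc-iut-L5-d2, proved from P. Stebe's conjugacy separability of free groups); this PROOF-ONLY file
(no definitions) plugs it into `lem217_i_of_hall_of_cent` (`Sec2DiscreteNormalizersInputs.lean`),
leaving Lemma 2.17 (i) modulo the single printed input (a) [SemiAnbd] Cor. 1.6 (ii) (tree FACT
`SemiGraphs.corollary_1_6_ii`, M. Hall's free-factor theorem, being discharged by abc-iut-L5-t16).

Honest framing: classical group theory; nothing here concerns [IUTchIII] Cor. 3.12; typed ≠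
discharged — Lemma 2.17 (i) is discharged here MODULO (a).
-/

namespace Literature.AnabelianGeometry.EtaleTheta.DiscreteNormalizers

open CategoryTheory ProfiniteGrp ProfiniteGrp.ProfiniteCompletion

universe u

/-- Input (c) of the proof of [EtTh] Lem. 2.17 (i) — "the centralizer of `x_{i_j}` in the profinite
completion `Ĵ` of `J` is topologically generated by `x_{i_j}`" (p.59) — in the shape consumed by
`lem217_i_of_facts`, from the tree theorem of abc-iut-L5-d2.
[cite: MochizukiEtTh2009, Lem 2.17(i) p.59] -/
theorem centralizer_basis_le_closure_zpowers :
    ∀ (J : Type u) [Group J] (κ : Type u) (β : FreeGroupBasis κ J) (i : κ),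
      let η : J →* ProfiniteGrp.ProfiniteCompletion.completion (GrpCat.of J) :=
        (ProfiniteGrp.ProfiniteCompletion.eta (GrpCat.of J)).hom
      Subgroup.centralizer {η (β i)} ≤ (Subgroup.zpowers (η (β i))).topologicalClosure :=
  fun J _ κ β i =>
    Literature.IUT.HodgeTheaters.ProfiniteCompletion.centralizer_eta_basis_le_closure_zpowers J κ β i

/-- **[EtTh] Lemma 2.17 (i)** in the typed shape of `ThetaCovers.TemperedCoverData.Lem217_i`, with the
printed inputs (b) "Stebe" and (c) "centralizers of free generators" DISCHARGED by tree theorems;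
the only remaining hypothesis is the printed input (a) [SemiAnbd] Cor. 1.6 (ii) (`hHall`, tree FACT
`SemiGraphs.corollary_1_6_ii`). [cite: MochizukiEtTh2009, Lem 2.17(i) pp.58–59] -/
theorem lem217_i_of_hall (hHall : SemiGraphs.corollary_1_6_ii.{u}) :
    ∀ (F : Type u) [Group F] (G H : Subgroup F) [IsFreeGroup G], G.Normal → G.FiniteIndex →
      Finite (IsFreeGroup.Generators G) → (∃ a ∈ H ⊓ G, ∃ b ∈ H ⊓ G, a * b ≠ b * a) →
      let η : F →* ProfiniteGrp.ProfiniteCompletion.completion (GrpCat.of F) :=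
        (ProfiniteGrp.ProfiniteCompletion.eta (GrpCat.of F)).hom
      Subgroup.normalizer ((H.map η : Subgroup _) : Set _) =
        (Subgroup.normalizer (H : Set F)).map η :=
  lem217_i_of_hall_of_cent hHall centralizer_basis_le_closure_zpowers

end Literature.AnabelianGeometry.EtaleTheta.DiscreteNormalizers
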